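import Summits.ValiantsHypothesis.ValiantsHypothesis.Theorems.SOSTauSOSTauStubGaussPair

/-!
# Crux `SOSTau.SOSTau` (stmt-ValiantsHypothesis-18748), line `Sketch` — registered stub
`stub_gaussPairGen` (Gλ): THE GAUSSIAN PAIR INEQUALITIES FOR EVERY RATIO `λ > 1`

**Claim settled** (TRUE).  Let `c` be standard Gaussian on `EuclideanSpace ℝ (Fin n)`
(`ProbabilityTheory.stdGaussian`) and `U ⊥ V` with `U ≠ 0`; put `X = ⟪c, U⟫`, `Y = ⟪c, V⟫`.
For every `λ > 1` there is `κ = κ(λ) > 0` such that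
* if `‖U‖ = ‖V‖` then `P[X² < Y²] ≥ 1/2` (this is the `λ`-free half of the landed
  `stub_gaussPair`);
* if `‖U‖² ≥ λ ‖V‖²` then `P[Y² < X²] ≥ 1/2 + κ`.

Proof (the landed ratio-`3` file `SOSTauSOSTauStubGaussPair` is the template; its helpers
`gaussPair_transfer`, `gaussPair_half_le'`, `gaussPair_Icc_pos`, `stub_gaussPair` are reused).
On `ℝ × ℝ` with `γ ⊗ γ` (`γ = gaussianReal 0 1`): for `1 < a < b` with `b² < λ` the box
`[1, a] × [a, b]` lies in `{x² ≤ y²} ∩ {y² < λ x²}`, which is disjoint from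
`{y² < x²} ⊆ {y² < λ x²}`; hence `γ ⊗ γ {y² < λ x²} ≥ 1/2 + γ [1, a] · γ [a, b]`, and the
product is positive (`volume ≪ γ`).  An admissible choice is `b = √((1 + λ)/2)` (so
`b² = (1 + λ)/2 < λ` and `1 < b`) and `a = (1 + b)/2`.
PULL BACK: the law of `(⟪U, c⟫, ⟪V, c⟫)` is the image of `γ ⊗ γ` under
`(x, y) ↦ (‖U‖ x, ‖V‖ y)` (`gaussPair_transfer`), and for `λ ‖V‖² ≤ ‖U‖²`, `‖U‖ > 0` the event
`{(‖V‖ y)² < (‖U‖ x)²}` contains `{y² < λ x²}`: `λ ‖V‖² y² ≤ ‖U‖² y² < ‖U‖² λ x²`.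

Unconditional (axioms `propext`, `Classical.choice`, `Quot.sound`); Mathlib only.
-/

-- layout Summits/ValiantsHypothesis/ValiantsHypothesis forces the duplicated namespace component
set_option linter.dupNamespace false

namespace Summit.ValiantsHypothesis.ValiantsHypothesis.Theorems.SOSTauSOSTau

open MeasureTheory ProbabilityTheory
open scoped RealInnerProductSpace

/-! ### The standard Gaussian pair `γ ⊗ γ` on `ℝ × ℝ`: general ratio `λ` -/

/-- The box `[1, a] × [a, b]` lies inside `{x² ≤ y² < λ x²}` as soon as `1 < a` and `b² < λ`. -/
theorem gaussPairGen_box_subset {a b lam : ℝ} (ha : 1 < a) (hb : b ^ 2 < lam) :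
    Set.Icc (1 : ℝ) a ×ˢ Set.Icc a b ⊆
      {q : ℝ × ℝ | q.1 ^ 2 ≤ q.2 ^ 2} ∩ {q : ℝ × ℝ | q.2 ^ 2 < lam * q.1 ^ 2} := by
  rintro ⟨x, y⟩ ⟨⟨hx1, hx2⟩, ⟨hy1, hy2⟩⟩
  simp only [Set.mem_inter_iff, Set.mem_setOf_eq]
  have hlam : 0 < lam := (sq_nonneg b).trans_lt hb
  refine ⟨pow_le_pow_left₀ (by linarith) (hx2.trans hy1) 2, ?_⟩
  calc y ^ 2 ≤ b ^ 2 := pow_le_pow_left₀ (by linarith) hy2 2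
    _ < lam := hb
    _ = lam * 1 := (mul_one _).symm
    _ ≤ lam * x ^ 2 := by gcongr; nlinarith

/-- `γ ⊗ γ {y² < λ x²} ≥ 1/2 + κ` with `κ = γ [1, a] · γ [a, b]`, for `1 < a < b`, `b² < λ`. -/
theorem gaussPairGen_lower {a b lam : ℝ} (ha : 1 < a) (hab : a < b) (hb : b ^ 2 < lam) :
    1 / 2 + (gaussianReal 0 1).real (Set.Icc 1 a) *
        (gaussianReal 0 1).real (Set.Icc a b) ≤
      ((gaussianReal 0 1).prod (gaussianReal 0 1)).real
        {q : ℝ × ℝ | q.2 ^ 2 < lam * q.1 ^ 2} := by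
  have hlam : 1 < lam := by nlinarith
  have hB : MeasurableSet
      ({q : ℝ × ℝ | q.1 ^ 2 ≤ q.2 ^ 2} ∩ {q : ℝ × ℝ | q.2 ^ 2 < lam * q.1 ^ 2}) :=
    (measurableSet_le (by fun_prop) (by fun_prop)).inter
      (measurableSet_lt (by fun_prop) (by fun_prop))
  have hdisj : Disjoint {q : ℝ × ℝ | q.2 ^ 2 < q.1 ^ 2}
      ({q : ℝ × ℝ | q.1 ^ 2 ≤ q.2 ^ 2} ∩ {q : ℝ × ℝ | q.2 ^ 2 < lam * q.1 ^ 2}) := by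
    rw [Set.disjoint_left]
    rintro q hq ⟨hq1, -⟩
    simp only [Set.mem_setOf_eq] at hq hq1
    exact absurd hq (not_lt.2 hq1)
  have hsub : {q : ℝ × ℝ | q.2 ^ 2 < q.1 ^ 2} ∪
        ({q : ℝ × ℝ | q.1 ^ 2 ≤ q.2 ^ 2} ∩ {q : ℝ × ℝ | q.2 ^ 2 < lam * q.1 ^ 2}) ⊆
      {q : ℝ × ℝ | q.2 ^ 2 < lam * q.1 ^ 2} := by
    rintro q (hq | ⟨-, hq⟩)
    · simp only [Set.mem_setOf_eq] at hq ⊢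
      nlinarith [sq_nonneg q.1]
    · exact hq
  calc 1 / 2 + (gaussianReal 0 1).real (Set.Icc 1 a) *
          (gaussianReal 0 1).real (Set.Icc a b)
      ≤ ((gaussianReal 0 1).prod (gaussianReal 0 1)).real {q : ℝ × ℝ | q.2 ^ 2 < q.1 ^ 2} +
          ((gaussianReal 0 1).prod (gaussianReal 0 1)).real
            (Set.Icc (1 : ℝ) a ×ˢ Set.Icc a b) :=
        add_le_add gaussPair_half_le' (measureReal_prod_prod _ _).symm.le
    _ ≤ ((gaussianReal 0 1).prod (gaussianReal 0 1)).real {q : ℝ × ℝ | q.2 ^ 2 < q.1 ^ 2} +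
          ((gaussianReal 0 1).prod (gaussianReal 0 1)).real
            ({q : ℝ × ℝ | q.1 ^ 2 ≤ q.2 ^ 2} ∩ {q : ℝ × ℝ | q.2 ^ 2 < lam * q.1 ^ 2}) :=
        add_le_add le_rfl (measureReal_mono (gaussPairGen_box_subset ha hb))
    _ = ((gaussianReal 0 1).prod (gaussianReal 0 1)).real ({q : ℝ × ℝ | q.2 ^ 2 < q.1 ^ 2} ∪
          ({q : ℝ × ℝ | q.1 ^ 2 ≤ q.2 ^ 2} ∩ {q : ℝ × ℝ | q.2 ^ 2 < lam * q.1 ^ 2})) :=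
        (measureReal_union hdisj hB).symm
    _ ≤ ((gaussianReal 0 1).prod (gaussianReal 0 1)).real
          {q : ℝ × ℝ | q.2 ^ 2 < lam * q.1 ^ 2} := measureReal_mono hsub

/-- Admissible box parameters exist for every `λ > 1`: `b = √((1 + λ)/2)`, `a = (1 + b)/2`. -/
theorem gaussPairGen_params {lam : ℝ} (hlam : 1 < lam) :
    ∃ a b : ℝ, 1 < a ∧ a < b ∧ b ^ 2 < lam := by
  obtain ⟨b, hb1, hb2⟩ : ∃ b : ℝ, 1 < b ∧ b ^ 2 < lam := by
    refine ⟨Real.sqrt ((1 + lam) / 2), (Real.lt_sqrt zero_le_one).2 (by nlinarith), ?_⟩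
    rw [Real.sq_sqrt (by linarith)]
    linarith
  exact ⟨(1 + b) / 2, b, by linarith, by linarith, hb2⟩

/-! ### The pair `(⟪U, ·⟫, ⟪V, ·⟫)` under `stdGaussian (EuclideanSpace ℝ (Fin n))` -/

variable {n : ℕ}

/-- Pull-back of the second event: for `λ ‖V‖² ≤ ‖U‖²`, `‖U‖ > 0`,
`P[⟪c, V⟫² < ⟪c, U⟫²] ≥ γ ⊗ γ {y² < λ x²}`. -/
theorem gaussPairGen_pullback {lam : ℝ} (hlam : 1 < lam) (U V : EuclideanSpace ℝ (Fin n))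
    (hUV : ⟪U, V⟫ = 0) (hU : 0 < ‖U‖) (hl : lam * ‖V‖ ^ 2 ≤ ‖U‖ ^ 2) :
    ((gaussianReal 0 1).prod (gaussianReal 0 1)).real
        {q : ℝ × ℝ | q.2 ^ 2 < lam * q.1 ^ 2} ≤
      (stdGaussian (EuclideanSpace ℝ (Fin n))).real {c | ⟪c, V⟫ ^ 2 < ⟪c, U⟫ ^ 2} := by
  have hA : MeasurableSet {p : ℝ × ℝ | p.2 ^ 2 < p.1 ^ 2} :=
    measurableSet_lt (by fun_prop) (by fun_prop)
  have hset : {c : EuclideanSpace ℝ (Fin n) | ⟪c, V⟫ ^ 2 < ⟪c, U⟫ ^ 2} =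
      {c | (⟪U, c⟫, ⟪V, c⟫) ∈ {p : ℝ × ℝ | p.2 ^ 2 < p.1 ^ 2}} := by
    ext c
    simp only [Set.mem_setOf_eq]
    rw [real_inner_comm U c, real_inner_comm V c]
  have hsub : {q : ℝ × ℝ | q.2 ^ 2 < lam * q.1 ^ 2} ⊆
      {q : ℝ × ℝ | (‖U‖ * q.1, ‖V‖ * q.2) ∈ {p : ℝ × ℝ | p.2 ^ 2 < p.1 ^ 2}} := by
    intro q hq
    simp only [Set.mem_setOf_eq] at hq ⊢
    rw [mul_pow, mul_pow]
    have hU2 : 0 < ‖U‖ ^ 2 := by positivity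
    have key : lam * (‖V‖ ^ 2 * q.2 ^ 2) < lam * (‖U‖ ^ 2 * q.1 ^ 2) :=
      calc lam * (‖V‖ ^ 2 * q.2 ^ 2) = lam * ‖V‖ ^ 2 * q.2 ^ 2 := by ring
        _ ≤ ‖U‖ ^ 2 * q.2 ^ 2 := by gcongr
        _ < ‖U‖ ^ 2 * (lam * q.1 ^ 2) := by gcongr
        _ = lam * (‖U‖ ^ 2 * q.1 ^ 2) := by ring
    exact lt_of_mul_lt_mul_left key (by linarith)
  rw [hset, gaussPair_transfer U V hUV hA]
  exact measureReal_mono hsub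

/-! ### The registered stub -/

/-- **Stub Gλ (`Stmt.gaussPairGen`).** For the standard Gaussian `c` on `ℝⁿ`, orthogonal `U, V`
with `U ≠ 0`, and any ratio `λ > 1`: if `‖U‖ = ‖V‖` then `⟨c,U⟩² < ⟨c,V⟩²` with probability
`≥ 1/2`; and with `κ = γ [1, a] · γ [a, b] > 0` (`γ = N(0,1)`, `b = √((1+λ)/2)`, `a = (1+b)/2`),
if `‖U‖² ≥ λ ‖V‖²` then `⟨c,V⟩² < ⟨c,U⟩²` with probability `≥ 1/2 + κ`. -/
theorem stub_gaussPairGen :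
    ∀ lam : ℝ, 1 < lam → ∃ κ : ℝ, 0 < κ ∧ ∀ (n : ℕ) (U V : EuclideanSpace ℝ (Fin n)),
      inner ℝ U V = 0 → 0 < ‖U‖ →
      (‖U‖ = ‖V‖ →
        (1 / 2 : ℝ) ≤ (stdGaussian (EuclideanSpace ℝ (Fin n))).real
          {c | inner ℝ c U ^ 2 < inner ℝ c V ^ 2}) ∧
      (lam * ‖V‖ ^ 2 ≤ ‖U‖ ^ 2 →
        1 / 2 + κ ≤ (stdGaussian (EuclideanSpace ℝ (Fin n))).real
          {c | inner ℝ c V ^ 2 < inner ℝ c U ^ 2}) := by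
  intro lam hlam
  obtain ⟨a, b, ha, hab, hb⟩ := gaussPairGen_params hlam
  refine ⟨(gaussianReal 0 1).real (Set.Icc 1 a) * (gaussianReal 0 1).real (Set.Icc a b),
    mul_pos (gaussPair_Icc_pos ha) (gaussPair_Icc_pos hab), ?_⟩
  intro n U V hUV hU
  obtain ⟨κ₃, -, h₃⟩ := stub_gaussPair
  exact ⟨(h₃ n U V hUV hU).1, fun hl =>
    (gaussPairGen_lower ha hab hb).trans (gaussPairGen_pullback hlam U V hUV hU hl)⟩

end Summit.ValiantsHypothesis.ValiantsHypothesis.Theorems.SOSTauSOSTau
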